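import Summits.BirchSwinnertonDyer.BirchSwinnertonDyer.Theorems.AlignedTransportAtTwoMainConjectureOfRankZeroBSDAtTwoPointFieldCarrierCM
import Literature.NumberTheory.IwasawaTheory.NarrowDefectBoundedOfClassicalMuAdjoinI
import HarnessLib

/-!
# Route `AlignedTransportAtTwo`, crux C2 `MainConjectureOfRankZeroBSDAtTwo` (stmt-BirchSwinnertonDyer-22298):
# PFμ⁺'s CONCLUSION ⟺ `μ₂ = 0` FOR THE CM POINT FIELD `ℚ(β, √−1)` — the descent, the equivalence, and the forms on C2's binders

Sequel of `…PointFieldCarrierCM` (same seat `bsd-line-att-p3` g34; there: the ascent `ℚ(β_j, √−1) → ℚ(W[2], √−1)`, quadratic over a totally complex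
base). HONEST FRAMING: WIDTH-5 attached prover seat on line `birth` of the lead `bsd-line-att-p2`; `--supports` stmt-BirchSwinnertonDyer-22298, closes nothing;
BSD is NOT proved; crux C2, its verdict «blocked-on `Rank1Residual.GreenbergMuConjectureIrreducible`» and every registered stub untouched (PFμ⁺ =
`PointFieldMuCycAtTwo` stays OPEN; its conclusion is RE-PRICED, not proved). THEOREMS ONLY.

* §3 `classicalMuVanishes_pointFieldCM_of_sup_adjoin_I` (finite descent, no hypothesis) and ★★ `classicalMuVanishes_sup_adjoin_I_iff_pointFieldCM` —
  `W(ℚ)[2] = 0`, `Δ_W, 2Δ_W, −2Δ_W, −Δ_W ∉ ℚ²`, `i² = −1`, any `j`: **(∀ cyclotomic `κ` on `ℚ(W[2]) ⊔ ℚ⟮i⟯`, `μ = 0`) ⟺ (∀ cyclotomic `κ` on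
  `ℚ⟮β_j⟯ ⊔ ℚ⟮i⟯`, `μ = 0`)**; `…_of_Δ_pos` (only `Δ_W, 2Δ_W ∉ ℚ²` remain); `classicalMuVanishes_cubic_of_sup_adjoin_I` and
  `classicalMuVanishes_divisionField_two_of_sup_adjoin_I` (PFμ⁺(W) ⟹ `μ₂(ℚ(β_j)) = 0` ⟹ `μ₂(ℚ(W[2])) = 0`, via att-p3 g34's resolvent-free descent).
* §4 on C2's binders (`W` globally minimal, good ordinary at `2`, no rational `2`-torsion abscissa, `Δ_W ∉ ℚ²`; `±2Δ_W ∉ ℚ²` automatic by att-p4 g29):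
  ★★ `classicalMuVanishes_sup_adjoin_I_iff_pointFieldCM_of_isOrdinaryAt{,_of_Δ_pos}` — **on the crux's whole domain the registered stub PFμ⁺ is,
  curve by curve, EXACTLY «`μ₂ = 0` for the CM sextic point field `ℚ(β, √−1)`»** (on `Δ_W < 0` this is also «`μ₂(ℚ(β)) = 0`», §5);
  `classicalMuVanishes_sup_adjoin_I_of_pointFieldCM'` (the ascent with `−Δ_W ∉ ℚ²` removed: if `−Δ_W ∈ ℚ²` the carrier lies inside `ℚ(β_j, i)`). Why no cheaper currency exists on `Δ_W > 0`:
  `Gal(ℚ(W[2], i)/ℚ) = S₃ × C₂` has ℚ-irreducibles `1, ε, σ, χ, εχ, σχ` and the `σχ`-isotypic part of the class groups is seen only by `ℚ(W[2], i)`,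
  `ℚ(β, i)`, `ℚ(β, √−Δ_W)` (multiplicities `2, 1, 1` in the permutation characters) — recorded in the crux workfile `REAL-RESOLVENT-MU-att-p3-g34.md`,
  not formalised here.

* §5 `Δ_W < 0`: ★ `classicalMuVanishes_pointFieldCM_iff_cubic_of_Δ_neg` — `μ₂(ℚ(β_j, √−1)^{cyc}) = 0 ⟺ μ₂(ℚ(β_j)^{cyc}) = 0` (through att-p4 g29's
  `…AdjoinIAscent`): on that half the cubic field, `ℚ(W[2])`, `ℚ(β_j, √−1)` and `ℚ(W[2], √−1)` carry one and the same `μ₂ = 0` statement.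

* §6 ★★★ `classicalMuVanishes_sup_adjoin_I_iff_of_isOrdinaryAt` — THE PRICE LIST OF PFμ⁺ on C2's binders, both signs: PFμ⁺'s conclusion for `W` ⟺
  (`Δ_W < 0 →` cubic `μ₂(ℚ(β_j)) = 0`) ∧ (`Δ_W > 0 →` CM `μ₂(ℚ(β_j, √−1)) = 0`).

* §7 ★★★ `classicalMuVanishes_sup_adjoin_I_iff_classicalMu_and_narrowDefect_le_cubic{,_of_isOrdinaryAt}` — composing with att-p4 g26's
  `classicalMu_sup_adjoin_iff_classicalMu_and_narrowDefect_le` (cubic, odd degree): **PFμ⁺(W) ⟺ (μ₂(ℚ(β_j)) = 0 ∧ bounded narrow 2-defect along the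
  cubic towers)** — the registered stub IS the Kida-lite narrow datum of the cubic point field, both signs, no sextic narrow/unit-signature datum.

* §8 ★★★ `pointFieldMuCyc_iff_signSplit` — the registered stub's ∀-W statement (binders and carrier VERBATIM) ⟺ PFμ⁻ (Δ<0: cubic μ₂) ∧ PFμ⁺₊
  (Δ>0: CM point-field μ₂) — the restatement menu item for the planner-of-record (D-0014); the stub stays open.

References: [Iwasawa1973MuInvariants] Thm. 2/3, §3; [Washington1997] Prop. 4.11, §13.1, §13.3 Prop. 13.23; [SilvermanAEC2009] VII.5 Prop. 5.1(a); tree: part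
`…PointFieldCarrierCM`, att-p4 g29 `…SignFreeAdjoinI`, att-p3 g34 `…ResolventMuUnconditional`, `ClassicalMuVanishesFiniteDescentNoGrowth`.
-/

set_option linter.dupNamespace false
set_option autoImplicit false

noncomputable section

open scoped Classical NumberField

namespace Summit.BirchSwinnertonDyer.BirchSwinnertonDyer.Theorems.AlignedTransportAtTwoPointFieldCarrierCMIff

open NumberField Polynomial WeierstrassCurve IntermediateField Field
  Literature.NumberTheory.EllipticCurves Literature.NumberTheory.EllipticCurves.Greenberg1999
  Literature.NumberTheory.EllipticCurves.DokchitserDokchitser2012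
  Literature.NumberTheory.EllipticCurves.ZpExtension Literature.NumberTheory.GaloisRepresentations
  Literature.NumberTheory.IwasawaTheory Literature.NumberTheory.NumberFields
  Summit.BirchSwinnertonDyer.BirchSwinnertonDyer.Theorems.AlignedTransportAtTwoFineRoad.DivisionCubic
  Summit.BirchSwinnertonDyer.BirchSwinnertonDyer.Theorems.AlignedTransportAtTwoFineRoad.TowerImageDelta
  Summit.BirchSwinnertonDyer.BirchSwinnertonDyer.Theorems.AlignedTransportAtTwoSexticNormRelationDescent
  Summit.BirchSwinnertonDyer.BirchSwinnertonDyer.Theorems.AlignedTransportAtTwoSexticNormRelationDescentSignFree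
  Summit.BirchSwinnertonDyer.BirchSwinnertonDyer.Theorems.AlignedTransportAtTwoSexticNormRelationDescentSignFreeAdjoinI
  Summit.BirchSwinnertonDyer.BirchSwinnertonDyer.Theorems.AlignedTransportAtTwoSexticNormRelationDescentAdjoinIAscent
  Summit.BirchSwinnertonDyer.BirchSwinnertonDyer.Theorems.AlignedTransportAtTwoResolventMuUnconditional
  Summit.BirchSwinnertonDyer.BirchSwinnertonDyer.Theorems.AlignedTransportAtTwoPointFieldCarrierCM

variable (W : WeierstrassCurve ℚ) [W.IsElliptic]

/-! ## §3 The descent and the equivalence -/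

/-- **`μ₂(ℚ(W[2], √−1)^{cyc}) = 0 ⟹ μ₂(ℚ(β_j, √−1)^{cyc}) = 0`** (`ℚ⟮β_j⟯ ⊔ ℚ⟮i⟯ ≤ ℚ(W[2]) ⊔ ℚ⟮i⟯`; finite descent, no hypothesis on `W` beyond ellipticity).
[cite: Iwasawa1973MuInvariants, §3 (remark after Thm. 2)] [cite: Washington1997, Prop. 4.11 and §13.1] -/
theorem classicalMuVanishes_pointFieldCM_of_sup_adjoin_I {i : AlgebraicClosure ℚ} (hi : i ^ 2 = -1) (j : Fin 3)
    (hM : ∀ κL : ZpExtension ↥(W.divisionField 2 ⊔ IntermediateField.adjoin ℚ ({i} : Set (AlgebraicClosure ℚ))) 2,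
      κL.IsCyclotomic → ClassicalMuVanishes κL) :
    ∀ κP : ZpExtension ↥(ℚ⟮xT W two_ne_zero j⟯ ⊔ IntermediateField.adjoin ℚ ({i} : Set (AlgebraicClosure ℚ))) 2,
      κP.IsCyclotomic → ClassicalMuVanishes κP := by
  set Qi : IntermediateField ℚ (AlgebraicClosure ℚ) := IntermediateField.adjoin ℚ ({i} : Set (AlgebraicClosure ℚ)) with hQi
  have hint : IsIntegral ℚ i := by
    refine ⟨X ^ 2 + 1, monic_X_pow_add_C _ two_ne_zero, ?_⟩
    simp [hi]
  have hβint : IsIntegral ℚ (xT W two_ne_zero j) := ((AlgebraicClosure.isAlgebraic ℚ).isAlgebraic _).isIntegral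
  haveI : FiniteDimensional ℚ ↥Qi := IntermediateField.adjoin.finiteDimensional hint
  haveI : FiniteDimensional ℚ ↥ℚ⟮xT W two_ne_zero j⟯ := IntermediateField.adjoin.finiteDimensional hβint
  haveI : NumberField ↥(W.divisionField 2) := NumberField.mk
  haveI : FiniteDimensional ℚ ↥(W.divisionField 2 ⊔ Qi) := IntermediateField.finiteDimensional_sup (W.divisionField 2) Qi
  haveI : NumberField ↥(W.divisionField 2 ⊔ Qi) := NumberField.of_module_finite ℚ _
  haveI : FiniteDimensional ℚ ↥(ℚ⟮xT W two_ne_zero j⟯ ⊔ Qi) := IntermediateField.finiteDimensional_sup ℚ⟮xT W two_ne_zero j⟯ Qi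
  haveI : NumberField ↥(ℚ⟮xT W two_ne_zero j⟯ ⊔ Qi) := NumberField.of_module_finite ℚ _
  have hle : ℚ⟮xT W two_ne_zero j⟯ ⊔ Qi ≤ W.divisionField 2 ⊔ Qi :=
    sup_le_sup_right (adjoin_simple_le_iff.mpr (xT_mem W j)) _
  intro κP hκP
  exact classicalMuVanishes_of_isCyclotomic_of_le_noGrowth hle hM κP hκP

/-- ★★ **`μ₂(ℚ(β_j, √−1)^{cyc}) = 0 ⟹ μ₂(ℚ(W[2], √−1)^{cyc}) = 0` WITHOUT `−Δ_W ∉ ℚ²`** (`W(ℚ)[2] = 0`, `Δ_W, 2Δ_W, −2Δ_W ∉ ℚ²`, `i² = −1`): if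
`−Δ_W = c²` then `δ = ±c·i ∈ ℚ⟮i⟯`, so `ℚ(W[2]) = ℚ⟮β_j⟯ ⊔ ℚ⟮δ⟯ ≤ ℚ⟮β_j⟯ ⊔ ℚ⟮i⟯` and the carrier lies INSIDE the CM point field — finite descent;
otherwise part A's quadratic ascent. [cite: Iwasawa1973MuInvariants, Thm. 3, §3 and §4] [cite: Washington1997, §13.3 Prop. 13.23] -/
theorem classicalMuVanishes_sup_adjoin_I_of_pointFieldCM' (ht : ∀ x : ℚ, ¬ HasRationalTwoTorsionX W x) (hsq : ¬ IsSquare W.Δ)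
    (h2Δ : ¬ IsSquare (2 * W.Δ)) (hm2Δ : ¬ IsSquare (-2 * W.Δ)) {i : AlgebraicClosure ℚ} (hi : i ^ 2 = -1) (j : Fin 3)
    (hP : ∀ κP : ZpExtension ↥(ℚ⟮xT W two_ne_zero j⟯ ⊔ IntermediateField.adjoin ℚ ({i} : Set (AlgebraicClosure ℚ))) 2,
      κP.IsCyclotomic → ClassicalMuVanishes κP) :
    ∀ κL : ZpExtension ↥(W.divisionField 2 ⊔ IntermediateField.adjoin ℚ ({i} : Set (AlgebraicClosure ℚ))) 2,
      κL.IsCyclotomic → ClassicalMuVanishes κL := by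
  by_cases hnegΔ : IsSquare (-W.Δ)
  swap
  · exact classicalMuVanishes_sup_adjoin_I_of_pointFieldCM W ht hsq h2Δ hm2Δ hnegΔ hi j hP
  -- `−Δ_W = c²`: the carrier is contained in the CM point field
  set Qi : IntermediateField ℚ (AlgebraicClosure ℚ) := IntermediateField.adjoin ℚ ({i} : Set (AlgebraicClosure ℚ)) with hQi
  have hint : IsIntegral ℚ i := by
    refine ⟨X ^ 2 + 1, monic_X_pow_add_C _ two_ne_zero, ?_⟩
    simp [hi]
  have hβint : IsIntegral ℚ (xT W two_ne_zero j) := ((AlgebraicClosure.isAlgebraic ℚ).isAlgebraic _).isIntegral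
  haveI : FiniteDimensional ℚ ↥Qi := IntermediateField.adjoin.finiteDimensional hint
  haveI : FiniteDimensional ℚ ↥ℚ⟮xT W two_ne_zero j⟯ := IntermediateField.adjoin.finiteDimensional hβint
  haveI : NumberField ↥(W.divisionField 2) := NumberField.mk
  haveI : FiniteDimensional ℚ ↥(W.divisionField 2 ⊔ Qi) := IntermediateField.finiteDimensional_sup (W.divisionField 2) Qi
  haveI : NumberField ↥(W.divisionField 2 ⊔ Qi) := NumberField.of_module_finite ℚ _
  haveI : FiniteDimensional ℚ ↥(ℚ⟮xT W two_ne_zero j⟯ ⊔ Qi) := IntermediateField.finiteDimensional_sup ℚ⟮xT W two_ne_zero j⟯ Qi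
  haveI : NumberField ↥(ℚ⟮xT W two_ne_zero j⟯ ⊔ Qi) := NumberField.of_module_finite ℚ _
  obtain ⟨c, hc⟩ := hnegΔ
  have hiQi : i ∈ Qi := IntermediateField.mem_adjoin_simple_self ℚ i
  have hδsq : (4 * delta W two_ne_zero) ^ 2 = ((W.Δ : ℚ) : AlgebraicClosure ℚ) := (delta_mem_and_sq W).2
  have hprod : (4 * delta W two_ne_zero - (c : AlgebraicClosure ℚ) * i) * (4 * delta W two_ne_zero + (c : AlgebraicClosure ℚ) * i) = 0 := by
    have hΔc : ((W.Δ : ℚ) : AlgebraicClosure ℚ) = -((c : AlgebraicClosure ℚ) * c) := by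
      rw [show (W.Δ : ℚ) = -(c * c) by rw [← hc]; ring]; push_cast; ring
    linear_combination hδsq + hΔc - ((c : AlgebraicClosure ℚ)) ^ 2 * hi
  have hδQi : 4 * delta W two_ne_zero ∈ Qi := by
    have hcQi : (c : AlgebraicClosure ℚ) * i ∈ Qi := mul_mem (by exact_mod_cast IntermediateField.algebraMap_mem Qi c) hiQi
    rcases mul_eq_zero.mp hprod with h | h
    · rw [sub_eq_zero] at h; rw [h]; exact hcQi
    · rw [add_eq_zero_iff_eq_neg] at h; rw [h]; exact neg_mem hcQi
  have hT : W.divisionField 2 ≤ ℚ⟮xT W two_ne_zero j⟯ ⊔ Qi :=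
    (adjoin_xT_sup_adjoin_delta_eq_divisionField_two W ht hsq j).symm.le.trans
      (sup_le le_sup_left ((adjoin_simple_le_iff.mpr hδQi).trans le_sup_right))
  have hle : W.divisionField 2 ⊔ Qi ≤ ℚ⟮xT W two_ne_zero j⟯ ⊔ Qi := sup_le hT le_sup_right
  intro κL hκL
  exact classicalMuVanishes_of_isCyclotomic_of_le_noGrowth hle hP κL hκL

/-- ★★ **PFμ⁺'s conclusion for `W` ⟺ `μ₂(ℚ(β_j, √−1)^{cyc}) = 0`, BOTH SIGNS** (`W(ℚ)[2] = 0`, `Δ_W, 2Δ_W, −2Δ_W ∉ ℚ²`, `i² = −1`, any `j`; all cyclotomic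
`ℤ₂`-extensions, growth form): the `μ₂ = 0` statement of the registered stub `PointFieldMuCycAtTwo` on the degree-`12` carrier `ℚ(W[2], √−1)` is, curve by
curve, the `μ₂ = 0` statement for the CM sextic point field `ℚ(β_j, √−1)`. [cite: Iwasawa1973MuInvariants, Thm. 2 and Thm. 3, §3] [cite: Washington1997, §13.3 Prop. 13.23] -/
theorem classicalMuVanishes_sup_adjoin_I_iff_pointFieldCM (ht : ∀ x : ℚ, ¬ HasRationalTwoTorsionX W x) (hsq : ¬ IsSquare W.Δ)
    (h2Δ : ¬ IsSquare (2 * W.Δ)) (hm2Δ : ¬ IsSquare (-2 * W.Δ)) {i : AlgebraicClosure ℚ} (hi : i ^ 2 = -1) (j : Fin 3) :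
    (∀ κL : ZpExtension ↥(W.divisionField 2 ⊔ IntermediateField.adjoin ℚ ({i} : Set (AlgebraicClosure ℚ))) 2,
        κL.IsCyclotomic → ClassicalMuVanishes κL) ↔
      ∀ κP : ZpExtension ↥(ℚ⟮xT W two_ne_zero j⟯ ⊔ IntermediateField.adjoin ℚ ({i} : Set (AlgebraicClosure ℚ))) 2,
        κP.IsCyclotomic → ClassicalMuVanishes κP :=
  ⟨fun hM κP hκP ↦ classicalMuVanishes_pointFieldCM_of_sup_adjoin_I W hi j hM κP hκP,
    fun hP ↦ classicalMuVanishes_sup_adjoin_I_of_pointFieldCM' W ht hsq h2Δ hm2Δ hi j hP⟩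

/-- ★★ **`Δ_W > 0`: PFμ⁺'s conclusion for `W` ⟺ `μ₂(ℚ(β_j, √−1)^{cyc}) = 0`** with only `Δ_W ∉ ℚ²`, `2Δ_W ∉ ℚ²` assumed (`−Δ_W, −2Δ_W < 0` are no squares). On
this sign `ℚ(β_j)` is totally real and `ℚ(β_j, √−1)` is a CM field. [cite: Iwasawa1973MuInvariants, Thm. 2 and Thm. 3, §3] [cite: Washington1997, §13.3 Prop. 13.23] -/
theorem classicalMuVanishes_sup_adjoin_I_iff_pointFieldCM_of_Δ_pos (ht : ∀ x : ℚ, ¬ HasRationalTwoTorsionX W x) (hΔ : 0 < W.Δ)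
    (hsq : ¬ IsSquare W.Δ) (h2Δ : ¬ IsSquare (2 * W.Δ)) {i : AlgebraicClosure ℚ} (hi : i ^ 2 = -1) (j : Fin 3) :
    (∀ κL : ZpExtension ↥(W.divisionField 2 ⊔ IntermediateField.adjoin ℚ ({i} : Set (AlgebraicClosure ℚ))) 2,
        κL.IsCyclotomic → ClassicalMuVanishes κL) ↔
      ∀ κP : ZpExtension ↥(ℚ⟮xT W two_ne_zero j⟯ ⊔ IntermediateField.adjoin ℚ ({i} : Set (AlgebraicClosure ℚ))) 2,
        κP.IsCyclotomic → ClassicalMuVanishes κP := by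
  have hm2Δ : ¬ IsSquare (-2 * W.Δ) := fun ⟨r, hr⟩ ↦ by nlinarith [mul_self_nonneg r]
  exact classicalMuVanishes_sup_adjoin_I_iff_pointFieldCM W ht hsq h2Δ hm2Δ hi j

/-- **PFμ⁺'s conclusion for `W` ⟹ `μ₂(ℚ(β_j)^{cyc}) = 0`** (finite descent `ℚ⟮β_j⟯ ≤ ℚ(W[2]) ⊔ ℚ⟮i⟯`; no hypothesis) — so, by att-p3 g34's
`…ResolventMuUnconditional`, also `μ₂(ℚ(W[2])^{cyc}) = 0` on the `S₃` locus. [cite: Iwasawa1973MuInvariants, §3 (remark after Thm. 2)] [cite: Washington1997, Prop. 4.11] -/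
theorem classicalMuVanishes_cubic_of_sup_adjoin_I {i : AlgebraicClosure ℚ} (hi : i ^ 2 = -1) (j : Fin 3)
    (hM : ∀ κL : ZpExtension ↥(W.divisionField 2 ⊔ IntermediateField.adjoin ℚ ({i} : Set (AlgebraicClosure ℚ))) 2,
      κL.IsCyclotomic → ClassicalMuVanishes κL)
    (κj : ZpExtension ↥ℚ⟮xT W two_ne_zero j⟯ 2) (hκj : κj.IsCyclotomic) : ClassicalMuVanishes κj := by
  set Qi : IntermediateField ℚ (AlgebraicClosure ℚ) := IntermediateField.adjoin ℚ ({i} : Set (AlgebraicClosure ℚ)) with hQi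
  have hint : IsIntegral ℚ i := by
    refine ⟨X ^ 2 + 1, monic_X_pow_add_C _ two_ne_zero, ?_⟩
    simp [hi]
  have hβint : IsIntegral ℚ (xT W two_ne_zero j) := ((AlgebraicClosure.isAlgebraic ℚ).isAlgebraic _).isIntegral
  haveI : FiniteDimensional ℚ ↥Qi := IntermediateField.adjoin.finiteDimensional hint
  haveI : FiniteDimensional ℚ ↥ℚ⟮xT W two_ne_zero j⟯ := IntermediateField.adjoin.finiteDimensional hβint
  haveI : NumberField ↥ℚ⟮xT W two_ne_zero j⟯ := NumberField.of_module_finite ℚ _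
  haveI : NumberField ↥(W.divisionField 2) := NumberField.mk
  haveI : FiniteDimensional ℚ ↥(W.divisionField 2 ⊔ Qi) := IntermediateField.finiteDimensional_sup (W.divisionField 2) Qi
  haveI : NumberField ↥(W.divisionField 2 ⊔ Qi) := NumberField.of_module_finite ℚ _
  have hle : ℚ⟮xT W two_ne_zero j⟯ ≤ W.divisionField 2 ⊔ Qi := (adjoin_simple_le_iff.mpr (xT_mem W j)).trans le_sup_left
  exact classicalMuVanishes_of_isCyclotomic_of_le_noGrowth hle hM κj hκj

/-- **PFμ⁺'s conclusion for `W` ⟹ `μ₂(ℚ(W[2])^{cyc}) = 0`** on the `S₃` locus (`W(ℚ)[2] = 0`, `Δ_W, 2Δ_W ∉ ℚ²`; both signs): the cubic descent above and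
att-p3 g34's `classicalMuVanishes_divisionField_two_of_single_cubic_of_not_isSquare` (resolvent input free). [cite: Iwasawa1973MuInvariants, §3]
[cite: BiasseEtAl2022, Prop. 3.7] -/
theorem classicalMuVanishes_divisionField_two_of_sup_adjoin_I (ht : ∀ x : ℚ, ¬ HasRationalTwoTorsionX W x) (hsq : ¬ IsSquare W.Δ)
    (h2Δ : ¬ IsSquare (2 * W.Δ)) {i : AlgebraicClosure ℚ} (hi : i ^ 2 = -1)
    (hM : ∀ κL : ZpExtension ↥(W.divisionField 2 ⊔ IntermediateField.adjoin ℚ ({i} : Set (AlgebraicClosure ℚ))) 2,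
      κL.IsCyclotomic → ClassicalMuVanishes κL)
    (κT : ZpExtension (W.divisionField 2) 2) (hκT : κT.IsCyclotomic) : ClassicalMuVanishes κT :=
  AlignedTransportAtTwoResolventMuUnconditional.classicalMuVanishes_divisionField_two_of_single_cubic_of_not_isSquare W ht hsq h2Δ 0
    (fun κj hκj ↦ classicalMuVanishes_cubic_of_sup_adjoin_I W hi 0 hM κj hκj) κT hκT

/-! ## §4 On C2's own binders -/

/-- ★★ **On the crux's `Δ_W > 0` quarter, PFμ⁺ IS «`μ₂ = 0` for the CM point field `ℚ(β, √−1)`».** `W` globally minimal, good ordinary at `2`, no rational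
`2`-torsion abscissa, `Δ_W ∉ ℚ²`, `Δ_W > 0` (`2Δ_W ∉ ℚ²` automatic, att-p4 g29); `i² = −1`, any `j`: the conclusion of `PointFieldMuCycAtTwo` for `W` and `i` holds
iff `μ₂ = 0` for every cyclotomic `ℤ₂`-extension of `ℚ⟮β_j⟯ ⊔ ℚ⟮i⟯`. (On `Δ_W < 0` att-p4 g29's `…AdjoinIAscent` prices it by `μ₂(ℚ(β_j))` alone.) Nothing closed.
[cite: Iwasawa1973MuInvariants, Thm. 2 and Thm. 3, §3] [cite: SilvermanAEC2009, VII.5 Prop. 5.1(a)] -/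
theorem classicalMuVanishes_sup_adjoin_I_iff_pointFieldCM_of_isOrdinaryAt_of_Δ_pos [W.IsGloballyMinimal] (hord : IsOrdinaryAt W 2)
    (ht : ∀ x : ℚ, ¬ HasRationalTwoTorsionX W x) (hsq : ¬ IsSquare W.Δ) (hΔ : 0 < W.Δ) {i : AlgebraicClosure ℚ} (hi : i ^ 2 = -1) (j : Fin 3) :
    (∀ κL : ZpExtension ↥(W.divisionField 2 ⊔ IntermediateField.adjoin ℚ ({i} : Set (AlgebraicClosure ℚ))) 2,
        κL.IsCyclotomic → ClassicalMuVanishes κL) ↔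
      ∀ κP : ZpExtension ↥(ℚ⟮xT W two_ne_zero j⟯ ⊔ IntermediateField.adjoin ℚ ({i} : Set (AlgebraicClosure ℚ))) 2,
        κP.IsCyclotomic → ClassicalMuVanishes κP :=
  classicalMuVanishes_sup_adjoin_I_iff_pointFieldCM_of_Δ_pos W ht hΔ hsq (not_isSquare_two_mul_Δ_of_isOrdinaryAt W hord) hi j

/-- **On C2's binders, both signs**: `μ₂(ℚ(β_j, √−1)^{cyc}) = 0` ⟹ the conclusion of `PointFieldMuCycAtTwo` for `W` and `i`
(`±2Δ_W ∉ ℚ²` automatic: att-p4 g29 `not_isSquare_two_mul_Δ_of_isOrdinaryAt` / `not_isSquare_neg_two_mul_Δ_of_isOrdinaryAt`). Nothing closed.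
[cite: Iwasawa1973MuInvariants, Thm. 2 and Thm. 3, §4] [cite: SilvermanAEC2009, VII.5 Prop. 5.1(a)] -/
theorem classicalMuVanishes_sup_adjoin_I_of_pointFieldCM_of_isOrdinaryAt [W.IsGloballyMinimal] (hord : IsOrdinaryAt W 2)
    (ht : ∀ x : ℚ, ¬ HasRationalTwoTorsionX W x) (hsq : ¬ IsSquare W.Δ) {i : AlgebraicClosure ℚ} (hi : i ^ 2 = -1) (j : Fin 3)
    (hP : ∀ κP : ZpExtension ↥(ℚ⟮xT W two_ne_zero j⟯ ⊔ IntermediateField.adjoin ℚ ({i} : Set (AlgebraicClosure ℚ))) 2,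
      κP.IsCyclotomic → ClassicalMuVanishes κP) :
    ∀ κL : ZpExtension ↥(W.divisionField 2 ⊔ IntermediateField.adjoin ℚ ({i} : Set (AlgebraicClosure ℚ))) 2,
      κL.IsCyclotomic → ClassicalMuVanishes κL :=
  classicalMuVanishes_sup_adjoin_I_of_pointFieldCM' W ht hsq (not_isSquare_two_mul_Δ_of_isOrdinaryAt W hord)
    (not_isSquare_neg_two_mul_Δ_of_isOrdinaryAt W hord) hi j hP

/-! ## §5 `Δ_W < 0`: everything is the cubic `μ` -/

/-- ★ **`Δ_W < 0`: `μ₂(ℚ(β_j, √−1)^{cyc}) = 0 ⟺ μ₂(ℚ(β_j)^{cyc}) = 0`** (`W(ℚ)[2] = 0`, `Δ_W < 0`, `−2Δ_W ∉ ℚ²`, `i² = −1`): `⟹` by finite descent along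
`ℚ⟮β_j⟯ ≤ ℚ⟮β_j⟯ ⊔ ℚ⟮i⟯`; `⟸` through the carrier: att-p4 g29's `classicalMuVanishes_sup_adjoin_I_of_single_cubic_of_Δ_neg` (cubic ⟹ `ℚ(W[2], √−1)`)
followed by §3's descent to `ℚ(β_j, √−1)`. So on the `Δ_W < 0` half the cubic field, the sextic `ℚ(W[2])`, the CM point field `ℚ(β_j, √−1)` and the PFμ⁺
carrier `ℚ(W[2], √−1)` all carry the SAME `μ₂ = 0` statement. [cite: Iwasawa1973MuInvariants, Thm. 2 and Thm. 3, §3] [cite: Washington1997, Prop. 4.11] -/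
theorem classicalMuVanishes_pointFieldCM_iff_cubic_of_Δ_neg (ht : ∀ x : ℚ, ¬ HasRationalTwoTorsionX W x) (hΔ : W.Δ < 0)
    (hm2Δ : ¬ IsSquare (-2 * W.Δ)) {i : AlgebraicClosure ℚ} (hi : i ^ 2 = -1) (j : Fin 3) :
    (∀ κP : ZpExtension ↥(ℚ⟮xT W two_ne_zero j⟯ ⊔ IntermediateField.adjoin ℚ ({i} : Set (AlgebraicClosure ℚ))) 2,
        κP.IsCyclotomic → ClassicalMuVanishes κP) ↔
      ∀ κj : ZpExtension ↥ℚ⟮xT W two_ne_zero j⟯ 2, κj.IsCyclotomic → ClassicalMuVanishes κj := by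
  set Qi : IntermediateField ℚ (AlgebraicClosure ℚ) := IntermediateField.adjoin ℚ ({i} : Set (AlgebraicClosure ℚ)) with hQi
  have hint : IsIntegral ℚ i := by
    refine ⟨X ^ 2 + 1, monic_X_pow_add_C _ two_ne_zero, ?_⟩
    simp [hi]
  have hβint : IsIntegral ℚ (xT W two_ne_zero j) := ((AlgebraicClosure.isAlgebraic ℚ).isAlgebraic _).isIntegral
  haveI : FiniteDimensional ℚ ↥Qi := IntermediateField.adjoin.finiteDimensional hint
  haveI : FiniteDimensional ℚ ↥ℚ⟮xT W two_ne_zero j⟯ := IntermediateField.adjoin.finiteDimensional hβint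
  haveI : NumberField ↥ℚ⟮xT W two_ne_zero j⟯ := NumberField.of_module_finite ℚ _
  haveI : FiniteDimensional ℚ ↥(ℚ⟮xT W two_ne_zero j⟯ ⊔ Qi) := IntermediateField.finiteDimensional_sup ℚ⟮xT W two_ne_zero j⟯ Qi
  haveI : NumberField ↥(ℚ⟮xT W two_ne_zero j⟯ ⊔ Qi) := NumberField.of_module_finite ℚ _
  refine ⟨fun hP κj hκj ↦ ?_, fun hj ↦ ?_⟩
  · have hle : ℚ⟮xT W two_ne_zero j⟯ ≤ ℚ⟮xT W two_ne_zero j⟯ ⊔ Qi := le_sup_left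
    exact classicalMuVanishes_of_isCyclotomic_of_le_noGrowth hle hP κj hκj
  · exact classicalMuVanishes_pointFieldCM_of_sup_adjoin_I W hi j
      (classicalMuVanishes_sup_adjoin_I_of_single_cubic_of_Δ_neg W ht hΔ hm2Δ j hj hi)

/-- **On C2's binders, `Δ_W < 0` half** (`W` globally minimal, good ordinary at `2`, no rational `2`-torsion abscissa, `Δ_W < 0`; `−2Δ_W ∉ ℚ²` automatic):
`μ₂(ℚ(β_j, √−1)^{cyc}) = 0 ⟺ μ₂(ℚ(β_j)^{cyc}) = 0`. [cite: Iwasawa1973MuInvariants, Thm. 2 and Thm. 3, §3] [cite: SilvermanAEC2009, VII.5 Prop. 5.1(a)] -/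
theorem classicalMuVanishes_pointFieldCM_iff_cubic_of_isOrdinaryAt_of_Δ_neg [W.IsGloballyMinimal] (hord : IsOrdinaryAt W 2)
    (ht : ∀ x : ℚ, ¬ HasRationalTwoTorsionX W x) (hΔ : W.Δ < 0) {i : AlgebraicClosure ℚ} (hi : i ^ 2 = -1) (j : Fin 3) :
    (∀ κP : ZpExtension ↥(ℚ⟮xT W two_ne_zero j⟯ ⊔ IntermediateField.adjoin ℚ ({i} : Set (AlgebraicClosure ℚ))) 2,
        κP.IsCyclotomic → ClassicalMuVanishes κP) ↔
      ∀ κj : ZpExtension ↥ℚ⟮xT W two_ne_zero j⟯ 2, κj.IsCyclotomic → ClassicalMuVanishes κj :=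
  classicalMuVanishes_pointFieldCM_iff_cubic_of_Δ_neg W ht hΔ (not_isSquare_neg_two_mul_Δ_of_isOrdinaryAt W hord) hi j

/-- ★★ **On C2's binders, BOTH signs: PFμ⁺'s conclusion for `W` ⟺ `μ₂(ℚ(β_j, √−1)^{cyc}) = 0`** (`W` globally minimal, good ordinary at `2`, no rational
`2`-torsion abscissa, `Δ_W ∉ ℚ²`; `±2Δ_W ∉ ℚ²` automatic). [cite: Iwasawa1973MuInvariants, Thm. 2 and Thm. 3, §3] [cite: SilvermanAEC2009, VII.5 Prop. 5.1(a)] -/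
theorem classicalMuVanishes_sup_adjoin_I_iff_pointFieldCM_of_isOrdinaryAt [W.IsGloballyMinimal] (hord : IsOrdinaryAt W 2)
    (ht : ∀ x : ℚ, ¬ HasRationalTwoTorsionX W x) (hsq : ¬ IsSquare W.Δ) {i : AlgebraicClosure ℚ} (hi : i ^ 2 = -1) (j : Fin 3) :
    (∀ κL : ZpExtension ↥(W.divisionField 2 ⊔ IntermediateField.adjoin ℚ ({i} : Set (AlgebraicClosure ℚ))) 2,
        κL.IsCyclotomic → ClassicalMuVanishes κL) ↔
      ∀ κP : ZpExtension ↥(ℚ⟮xT W two_ne_zero j⟯ ⊔ IntermediateField.adjoin ℚ ({i} : Set (AlgebraicClosure ℚ))) 2,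
        κP.IsCyclotomic → ClassicalMuVanishes κP :=
  classicalMuVanishes_sup_adjoin_I_iff_pointFieldCM W ht hsq (not_isSquare_two_mul_Δ_of_isOrdinaryAt W hord)
    (not_isSquare_neg_two_mul_Δ_of_isOrdinaryAt W hord) hi j

/-! ## §6 The price of PFμ⁺ curve by curve, on C2's binders: cubic `μ` on `Δ_W < 0`, CM point-field `μ` on `Δ_W > 0` -/

/-- ★★★ **THE PRICE LIST OF PFμ⁺, BOTH SIGNS, ON THE CRUX'S BINDERS.** `W` globally minimal, good ordinary at `2`, no rational `2`-torsion abscissa,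
`Δ_W ∉ ℚ²`; `i² = −1`; any `j`. The conclusion of the registered stub `PointFieldMuCycAtTwo` for `W` and `i` («`μ₂ = 0` for every cyclotomic
`ℤ₂`-extension of `ℚ(W[2]) ⊔ ℚ⟮i⟯`») holds **iff** (`Δ_W < 0` ⟹ `μ₂ = 0` along the cyclotomic `ℤ₂`-tower of the complex cubic `ℚ(β_j)`) and
(`Δ_W > 0` ⟹ `μ₂ = 0` along the cyclotomic `ℤ₂`-tower of the CM sextic `ℚ(β_j, √−1)`). (`Δ_W ≠ 0`; `Δ_W < 0`: att-p4 g29's `…AdjoinIAscent` + §3's cubic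
descent; `Δ_W > 0`: §4.) In the C2 input ledger: PFμ⁺ = «H3M on the `Δ < 0` three quarters» ⊕ «CM-point-field `μ₂` on the `Δ > 0` quarter». Nothing closed.
[cite: Iwasawa1973MuInvariants, Thm. 2 and Thm. 3, §3] [cite: SilvermanAEC2009, VII.5 Prop. 5.1(a)] -/
theorem classicalMuVanishes_sup_adjoin_I_iff_of_isOrdinaryAt [W.IsGloballyMinimal] (hord : IsOrdinaryAt W 2)
    (ht : ∀ x : ℚ, ¬ HasRationalTwoTorsionX W x) (hsq : ¬ IsSquare W.Δ) {i : AlgebraicClosure ℚ} (hi : i ^ 2 = -1) (j : Fin 3) :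
    (∀ κL : ZpExtension ↥(W.divisionField 2 ⊔ IntermediateField.adjoin ℚ ({i} : Set (AlgebraicClosure ℚ))) 2,
        κL.IsCyclotomic → ClassicalMuVanishes κL) ↔
      ((W.Δ < 0 → ∀ κj : ZpExtension ↥ℚ⟮xT W two_ne_zero j⟯ 2, κj.IsCyclotomic → ClassicalMuVanishes κj) ∧
        (0 < W.Δ → ∀ κP : ZpExtension ↥(ℚ⟮xT W two_ne_zero j⟯ ⊔ IntermediateField.adjoin ℚ ({i} : Set (AlgebraicClosure ℚ))) 2,
          κP.IsCyclotomic → ClassicalMuVanishes κP)) := by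
  have hΔ0 : W.Δ ≠ 0 := W.isUnit_Δ.ne_zero
  refine ⟨fun hM ↦ ⟨fun _ κj hκj ↦ classicalMuVanishes_cubic_of_sup_adjoin_I W hi j hM κj hκj,
      fun _ ↦ classicalMuVanishes_pointFieldCM_of_sup_adjoin_I W hi j hM⟩, fun h ↦ ?_⟩
  rcases lt_or_gt_of_ne hΔ0 with hneg | hpos
  · exact classicalMuVanishes_sup_adjoin_I_of_single_cubic_of_isOrdinaryAt_of_Δ_neg W hord ht hneg j (h.1 hneg) i hi
  · exact (classicalMuVanishes_sup_adjoin_I_iff_pointFieldCM_of_isOrdinaryAt_of_Δ_pos W hord ht hsq hpos hi j).mpr (h.2 hpos)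

/-! ## §7 … hence PFμ⁺ ⟺ Kida-lite NARROW data of the cubic point field (att-p4 g26's currency), both signs -/

/-- ★★★ **PFμ⁺'s conclusion for `W` ⟺ «`μ₂ = 0` AND BOUNDED NARROW `2`-DEFECT along the cyclotomic `ℤ₂`-towers of the cubic `ℚ(β_j)`»** (`W(ℚ)[2] = 0`,
`Δ_W, 2Δ_W, −2Δ_W ∉ ℚ²`, `i² = −1`, any `j`; both signs): §3's equivalence with the CM point field `ℚ(β_j, √−1) = ℚ⟮β_j⟯ ⊔ ℚ⟮i⟯` composed with att-p4 g26's
`classicalMu_sup_adjoin_iff_classicalMu_and_narrowDefect_le` (the cubic has odd degree `3`). So the registered stub PFμ⁺ is, curve by curve, EXACTLY the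
Kida-lite narrow datum «(a) ∧ (b)» of the cubic point field — the currency of the route's narrow models ledger (`…CubicNarrowRankDoorModelsAnyRung`,
`exists_narrowRung_anyRung_iff_narrowMuData`: one narrow rank rung fires) — with NO sextic narrow datum and NO unit-signature hypothesis on `ℚ(W[2])`.
[cite: Iwasawa1973MuInvariants, Thm. 2 and Thm. 3, §3–§4] [cite: Washington1997, §13.3 Prop. 13.22–13.23] [cite: Gras2003, IV.4] -/
theorem classicalMuVanishes_sup_adjoin_I_iff_classicalMu_and_narrowDefect_le_cubic (ht : ∀ x : ℚ, ¬ HasRationalTwoTorsionX W x)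
    (hsq : ¬ IsSquare W.Δ) (h2Δ : ¬ IsSquare (2 * W.Δ)) (hm2Δ : ¬ IsSquare (-2 * W.Δ)) {i : AlgebraicClosure ℚ} (hi : i ^ 2 = -1) (j : Fin 3) :
    (∀ κL : ZpExtension ↥(W.divisionField 2 ⊔ IntermediateField.adjoin ℚ ({i} : Set (AlgebraicClosure ℚ))) 2,
        κL.IsCyclotomic → ClassicalMuVanishes κL) ↔
      ((∀ κP : ZpExtension ↥ℚ⟮xT W two_ne_zero j⟯ 2, κP.IsCyclotomic → ClassicalMuVanishes κP) ∧
        ∃ D : ℕ, ∀ κP : ZpExtension ↥ℚ⟮xT W two_ne_zero j⟯ 2, κP.IsCyclotomic → ∀ n : ℕ, ∀ [NumberField ↥(κP.layer n)],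
          padicValNat 2 (narrowClassNumber ↥(κP.layer n)) ≤ padicValNat 2 (classNumber ↥(κP.layer n)) + D) := by
  have hβint : IsIntegral ℚ (xT W two_ne_zero j) := ((AlgebraicClosure.isAlgebraic ℚ).isAlgebraic _).isIntegral
  haveI : FiniteDimensional ℚ ↥ℚ⟮xT W two_ne_zero j⟯ := IntermediateField.adjoin.finiteDimensional hβint
  have hodd : Odd (Module.finrank ℚ ↥ℚ⟮xT W two_ne_zero j⟯) := by rw [finrank_adjoin_xT_model W ht j]; decide
  rw [classicalMuVanishes_sup_adjoin_I_iff_pointFieldCM W ht hsq h2Δ hm2Δ hi j]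
  exact classicalMu_sup_adjoin_iff_classicalMu_and_narrowDefect_le ℚ⟮xT W two_ne_zero j⟯ hodd hi

/-- ★★★ **On C2's binders, both signs: PFμ⁺'s conclusion for `W` ⟺ Kida-lite narrow data of the cubic `ℚ(β_j)`** (`W` globally minimal, good ordinary at `2`,
no rational `2`-torsion abscissa, `Δ_W ∉ ℚ²`; `±2Δ_W ∉ ℚ²` automatic). With att-p4 g26's models ledger: the SUFFICIENT narrow rung (`hNarrowModels`) is now
also what PFμ⁺ MEANS, curve by curve; the `Δ_W > 0` residual of PFμ⁺ is exactly the narrow-defect datum (b) of the totally real cubic. Nothing closed.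
[cite: Iwasawa1973MuInvariants, Thm. 2 and Thm. 3, §3–§4] [cite: SilvermanAEC2009, VII.5 Prop. 5.1(a)] -/
theorem classicalMuVanishes_sup_adjoin_I_iff_classicalMu_and_narrowDefect_le_cubic_of_isOrdinaryAt [W.IsGloballyMinimal]
    (hord : IsOrdinaryAt W 2) (ht : ∀ x : ℚ, ¬ HasRationalTwoTorsionX W x) (hsq : ¬ IsSquare W.Δ) {i : AlgebraicClosure ℚ} (hi : i ^ 2 = -1)
    (j : Fin 3) :
    (∀ κL : ZpExtension ↥(W.divisionField 2 ⊔ IntermediateField.adjoin ℚ ({i} : Set (AlgebraicClosure ℚ))) 2,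
        κL.IsCyclotomic → ClassicalMuVanishes κL) ↔
      ((∀ κP : ZpExtension ↥ℚ⟮xT W two_ne_zero j⟯ 2, κP.IsCyclotomic → ClassicalMuVanishes κP) ∧
        ∃ D : ℕ, ∀ κP : ZpExtension ↥ℚ⟮xT W two_ne_zero j⟯ 2, κP.IsCyclotomic → ∀ n : ℕ, ∀ [NumberField ↥(κP.layer n)],
          padicValNat 2 (narrowClassNumber ↥(κP.layer n)) ≤ padicValNat 2 (classNumber ↥(κP.layer n)) + D) :=
  classicalMuVanishes_sup_adjoin_I_iff_classicalMu_and_narrowDefect_le_cubic W ht hsq (not_isSquare_two_mul_Δ_of_isOrdinaryAt W hord)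
    (not_isSquare_neg_two_mul_Δ_of_isOrdinaryAt W hord) hi j

/-! ## §8 The registered stub PFμ⁺, restated sign-split (for the planner; same binders, verbatim carrier) -/

/-- ★★★ **PFμ⁺ ⟺ PFμ⁻ ∧ PFμ⁺₊ (the ∀-W forms).** The statement of the registered stub `PointFieldMuCycAtTwo` of line `birth` (binders verbatim: `W` globally
minimal, non-CM, good ordinary at `2`, no rational `2`-torsion abscissa, `Δ_W ∉ ℚ²`, analytic rank `0`, `BSD₂(W)`; carrier `ℚ(W[2]) ⊔ ℚ⟮i⟯` for every
`i² = −1`) is EQUIVALENT to the conjunction of: (PFμ⁻) on `Δ_W < 0`, `μ₂ = 0` for every cyclotomic `ℤ₂`-extension of the complex cubic `ℚ⟮β₀⟯`; (PFμ⁺₊) on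
`Δ_W > 0`, `μ₂ = 0` for every cyclotomic `ℤ₂`-extension of the CM sextic `ℚ⟮β₀⟯ ⊔ ℚ⟮i⟯` for every `i² = −1`. (§6 curve by curve; a square root of `−1`
exists in `ℚ̄`.) A restatement menu item for the planner-of-record (D-0014); the stub itself stays OPEN. Nothing closed.
[cite: Iwasawa1973MuInvariants, Thm. 2 and Thm. 3, §3–§4] [cite: SilvermanAEC2009, VII.5 Prop. 5.1(a)] -/
theorem pointFieldMuCyc_iff_signSplit :
    (∀ (W : WeierstrassCurve ℚ) [W.IsElliptic] [W.IsGloballyMinimal], ¬ W.HasCM →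
        IsOrdinaryAt W 2 → (∀ x : ℚ, ¬ HasRationalTwoTorsionX W x) → ¬ IsSquare W.Δ →
        W.analyticRank = 0 → BSDp W 2 →
        ∀ i : AlgebraicClosure ℚ, i ^ 2 = -1 →
        ∀ κL : ZpExtension ↥(W.divisionField 2 ⊔ IntermediateField.adjoin ℚ {i}) 2,
          κL.IsCyclotomic → ClassicalMuVanishes κL) ↔
    ((∀ (W : WeierstrassCurve ℚ) [W.IsElliptic] [W.IsGloballyMinimal], ¬ W.HasCM →
        IsOrdinaryAt W 2 → (∀ x : ℚ, ¬ HasRationalTwoTorsionX W x) → ¬ IsSquare W.Δ →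
        W.analyticRank = 0 → BSDp W 2 → W.Δ < 0 →
        ∀ κj : ZpExtension ↥ℚ⟮xT W two_ne_zero 0⟯ 2, κj.IsCyclotomic → ClassicalMuVanishes κj) ∧
      (∀ (W : WeierstrassCurve ℚ) [W.IsElliptic] [W.IsGloballyMinimal], ¬ W.HasCM →
        IsOrdinaryAt W 2 → (∀ x : ℚ, ¬ HasRationalTwoTorsionX W x) → ¬ IsSquare W.Δ →
        W.analyticRank = 0 → BSDp W 2 → 0 < W.Δ →
        ∀ i : AlgebraicClosure ℚ, i ^ 2 = -1 →
        ∀ κP : ZpExtension ↥(ℚ⟮xT W two_ne_zero 0⟯ ⊔ IntermediateField.adjoin ℚ {i}) 2,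
          κP.IsCyclotomic → ClassicalMuVanishes κP)) := by
  -- a square root of `−1` in `ℚ̄`
  obtain ⟨i₀, hi₀⟩ : ∃ i₀ : AlgebraicClosure ℚ, i₀ ^ 2 = -1 := IsAlgClosed.exists_pow_nat_eq (-1) two_pos
  refine ⟨fun h ↦ ⟨?_, ?_⟩, fun h ↦ ?_⟩
  · intro W _ _ hcm hord ht hsq hr hbsd hneg κj hκj
    exact ((classicalMuVanishes_sup_adjoin_I_iff_of_isOrdinaryAt W hord ht hsq hi₀ 0).mp (h W hcm hord ht hsq hr hbsd i₀ hi₀)).1 hneg κj hκj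
  · intro W _ _ hcm hord ht hsq hr hbsd hpos i hi
    exact ((classicalMuVanishes_sup_adjoin_I_iff_of_isOrdinaryAt W hord ht hsq hi 0).mp (h W hcm hord ht hsq hr hbsd i hi)).2 hpos
  · intro W _ _ hcm hord ht hsq hr hbsd i hi
    exact (classicalMuVanishes_sup_adjoin_I_iff_of_isOrdinaryAt W hord ht hsq hi 0).mpr
      ⟨fun hneg ↦ h.1 W hcm hord ht hsq hr hbsd hneg, fun hpos ↦ h.2 W hcm hord ht hsq hr hbsd hpos i hi⟩

end Summit.BirchSwinnertonDyer.BirchSwinnertonDyer.Theorems.AlignedTransportAtTwoPointFieldCarrierCMIff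

end
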